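import Summits.QuantumFields.YangMills.Theorems.BalabanUVNodesN19TiltPathRoad
import Mathlib.Analysis.SpecialFunctions.SmoothTransition

/-!
# BalabanUVNodes ∕ N19 — THE ANNEALED (TILT-PATH) ROAD, V: CALIBRATION BY THE MIXTURE PATH (ONE CLASS) — A C¹ CLAMP, THE CLAMPED
# m-GEODESIC AS A TILT PATH WITH ROAD II∕III's EVERYWHERE-ON-ℝ LETTERS, DRIFT ≡ log Z AND OSC ≡ 2·TV ON `[0,1]`

Cell `pub-ymgap` (HUMAN RULING D-0062, Track A), node N19 = NE7, R134 seat `pub-ymgap-dag-n19-c` (g17); first of two modules of bus INTENT-24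
(announce-before-typing).  Takes LENS control memo v6.2 §D (D3)(iii) («OPTIONAL one-lemma converse `tiltPath_of_mass_of_tv` … idle seat only, nobody's
duty, credit free»; re-offered to the N19 pens by dag-n14-c g8, bus l.19410 ∕ l.19949).  The one-class calculus below is the lens's sketch
`ym-lens-BalabanUVNodes-control/Sketch-control-g9.lean` 27be075ad5a82fec §2 — K13a∕b∕c∕d, SIGNATURES AND PROOFS CREDITED to seat
`ym-lens-BalabanUVNodes-control` (gen 9) — rescaled from a probability piece to a FINITE NON-NULL class piece (mass `m`, `Z := ∫e^{ψ₁}dμ ∕ m`) and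
composed with a C¹ clamp so that road II∕III's regularity letters, which are stated for EVERY `u ∈ ℝ`, are met.  Filed `--kind proof --supports` K3⁶
`SpineGivenEndpointR13SepCoPR` = stmt-QuantumFields-20509 `--as helper`.  COUNT-NEUTRAL.  THEOREMS ONLY (0 `def`); imports road III
`…N19TiltPathRoad` (hence II, I, 16a∕16b) and Mathlib `Real.smoothTransition`; edits nothing.

WHAT IS PROVED ([folklore] one-variable calculus + measure arithmetic).
* §1 THE C¹ CLAMP: `hasDerivAt_smoothTransition_of_neg` · ★ `exists_clamp` — for every `η > 0` a C¹ map `σ : ℝ → ℝ` with `σ = id`, `σ′ = 1` on `[0,1]`,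
  range in `[−η, 1 + η]`, `σ′` continuous (`σ u = u − (u−1)·χ((u−1)∕η) − u·χ(−u∕η)`, `χ` = Mathlib's `Real.smoothTransition`).
* §2 ONE CLASS.  `μ` finite, `≠ 0`, mass `m`; `ψ₁` measurable with `|ψ₁| ≤ M`; `Z = ∫e^{ψ₁}dμ ∕ m`, `ρ = e^{ψ₁}∕Z` (so `∫ρ dμ = m`, `e^{−2M} ≤ ρ ≤ e^{2M}`);
  the MIXTURE exponent `Φ s = log((1−s) + s·ρ) + s·log Z`, direction `Φ′ s = (ρ−1)∕((1−s) + s·ρ) + log Z`: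
  `mixture_aux` · `mixture_pos` (on `s ∈ [−η, 1+η]`, `η = e^{−2M}∕2`: `e^{−2M}∕2 ≤ (1−s) + s·ρ ≤ 2 + 2e^{2M}`) · `exp_mixture_eq` · `integral_exp_mixture`
  (`∫e^{Φ s}dμ = m·e^{s·log Z}`) · ★ `integral_dir_mixture` (K13b, DRIFT: `∫Φ′ s dμ̂_s = log Z` EXACTLY) · ★ `osc_mixture_eq` (K13c, OSC:
  `∫|Φ′ s − log Z| dμ̂_s = (1∕m)∫|ρ − 1|dμ` EXACTLY) · `hasDerivAt_mixture` (K13d) · ★★ `exists_mixturePath` (a tilt path with road II∕III's letters —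
  measurable, pointwise C¹ ON ℝ, locally uniformly bounded — with `ψ 0 = 0`, `ψ 1 = ψ₁`, and on `[0,1]`: DRIFT `≡ log Z`, OSC `≡ (1∕m)∫|ρ−1|dμ`; the
  clamped m-geodesic `Φ (σ u)`).
Module VI (`…N19TiltPathCircle`) reads `(1∕m)∫|ρ−1|dμ` as twice the total-variation distance of the normalised endpoint laws (16b's TV_cl letters) and
lifts §2 to the class level in road III's letters: the converse `tiltPath_of_mass_of_tv`, the ⟺ with III §2, OSC-optimality, 16b's sufficiency via III.

HONEST FRAMING.  [folklore]; a CALIBRATION of this lineage's road III (lens census V69: path freedom has zero logical leverage on the TV face — here a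
tree theorem), NOT a production interface and NOT an estimate of Bałaban's; SUPPORT-MATCHED case only; NE7 ∕ NE1′ NOT proved; N19 NOT discharged (0∕1);
N14 untouched; K3⁶ NOT claimed; counts UNMOVED (typed 28∕28 · discharged 5∕27 · A 5∕28); one finite four-torus programme at fixed `ε` — NOT ℝ⁴, NOT OS,
NOT a mass gap, NOT Clay.  0 `def`; 0 `sorry`; standard axioms.
-/

set_option autoImplicit false

noncomputable section

open MeasureTheory ProbabilityTheory Set Filter Topology
open scoped ENNReal

namespace Summit.QuantumFields.YangMills.BalabanUVNodes.N19TiltPathMixture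

/-! ## §1 A C¹ clamp: `σ = id` on `[0,1]`, range in `[−η, 1+η]` -/
section Clamp

/-- Mathlib's smooth transition `χ` is locally constant (`= 0`) left of the origin, so its derivative vanishes there. [folklore] -/
theorem hasDerivAt_smoothTransition_of_neg {x : ℝ} (hx : x < 0) : HasDerivAt Real.smoothTransition 0 x := by
  refine (hasDerivAt_const x (0 : ℝ)).congr_of_eventuallyEq ?_
  filter_upwards [Iio_mem_nhds hx] with y hy
  exact Real.smoothTransition.zero_of_nonpos (le_of_lt hy)

/-- ★ **A C¹ CLAMP.**  For every `η > 0` there is a C¹ map `σ : ℝ → ℝ` (derivative `σ′`, continuous) with `σ u = u` and `σ′ u = 1` on `[0,1]` and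
`−η ≤ σ ≤ 1 + η` everywhere: `σ u = u − (u − 1)·χ((u − 1)∕η) − u·χ(−u∕η)` with `χ` Mathlib's `Real.smoothTransition` (C^∞, `= 0` on `(−∞,0]`,
`= 1` on `[1,∞)`, values in `[0,1]`).  Used to re-parametrise a path defined near `[0,1]` into one defined on ℝ with the same `[0,1]`-data. [folklore] -/
theorem exists_clamp {η : ℝ} (hη : 0 < η) :
    ∃ σ σ' : ℝ → ℝ, (∀ u, HasDerivAt σ (σ' u) u) ∧ Continuous σ' ∧ (∀ u ∈ Icc (0 : ℝ) 1, σ u = u) ∧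
      (∀ u ∈ Icc (0 : ℝ) 1, σ' u = 1) ∧ ∀ u, -η ≤ σ u ∧ σ u ≤ 1 + η := by
  set χ : ℝ → ℝ := Real.smoothTransition with hχ
  have hχ1 : ContDiff ℝ 1 χ := Real.smoothTransition.contDiff (n := 1)
  have hχd : Differentiable ℝ χ := hχ1.differentiable one_ne_zero
  have hχc : Continuous χ := Real.smoothTransition.continuous
  have hχ'c : Continuous (deriv χ) := hχ1.continuous_deriv_one
  have hχ0 : ∀ x : ℝ, x ≤ 0 → χ x = 0 := fun x hx => Real.smoothTransition.zero_of_nonpos hx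
  have hχ1' : ∀ x : ℝ, 1 ≤ x → χ x = 1 := fun x hx => Real.smoothTransition.one_of_one_le hx
  have hχnn : ∀ x : ℝ, 0 ≤ χ x := Real.smoothTransition.nonneg
  have hχle : ∀ x : ℝ, χ x ≤ 1 := Real.smoothTransition.le_one
  have hχ'0 : ∀ x : ℝ, x < 0 → deriv χ x = 0 := fun x hx => (hasDerivAt_smoothTransition_of_neg hx).deriv
  refine ⟨fun u => u - (u - 1) * χ ((u - 1) / η) - u * χ (-u / η),
    fun u => 1 - (1 * χ ((u - 1) / η) + (u - 1) * (deriv χ ((u - 1) / η) * (1 / η))) -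
      (1 * χ (-u / η) + u * (deriv χ (-u / η) * (-1 / η))), fun u => ?_, ?_, fun u hu => ?_, fun u hu => ?_, fun u => ?_⟩
  · -- differentiability (product and chain rules)
    have h1 : HasDerivAt (fun v : ℝ => (v - 1) / η) (1 / η) u := by
      simpa using ((hasDerivAt_id u).sub_const (1 : ℝ)).div_const η
    have h1' : HasDerivAt (fun v : ℝ => v - 1) 1 u := by simpa using (hasDerivAt_id u).sub_const (1 : ℝ)
    have h2 : HasDerivAt (fun v : ℝ => -v / η) (-1 / η) u := by simpa using (hasDerivAt_neg u).div_const η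
    have hc1 : HasDerivAt (fun v : ℝ => χ ((v - 1) / η)) (deriv χ ((u - 1) / η) * (1 / η)) u :=
      (hχd _).hasDerivAt.comp u h1
    have hc2 : HasDerivAt (fun v : ℝ => χ (-v / η)) (deriv χ (-u / η) * (-1 / η)) u := (hχd _).hasDerivAt.comp u h2
    exact ((hasDerivAt_id' u).sub (h1'.mul hc1)).sub ((hasDerivAt_id' u).mul hc2)
  · -- continuity of `σ′`
    have ha : Continuous fun u : ℝ => (u - 1) / η := (continuous_id.sub continuous_const).div_const η
    have hb : Continuous fun u : ℝ => -u / η := continuous_neg.div_const η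
    exact (continuous_const.sub ((continuous_const.mul (hχc.comp ha)).add ((continuous_id.sub continuous_const).mul
      ((hχ'c.comp ha).mul continuous_const)))).sub ((continuous_const.mul (hχc.comp hb)).add (continuous_id.mul
        ((hχ'c.comp hb).mul continuous_const)))
  · -- `σ = id` on `[0,1]`
    beta_reduce
    have ha : (u - 1) / η ≤ 0 := div_nonpos_iff.2 (Or.inr ⟨by linarith [hu.2], hη.le⟩)
    have hb : -u / η ≤ 0 := div_nonpos_iff.2 (Or.inr ⟨by linarith [hu.1], hη.le⟩)
    simp only [hχ0 _ ha, hχ0 _ hb, mul_zero, sub_zero]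
  · -- `σ′ = 1` on `[0,1]`
    beta_reduce
    have ha : (u - 1) / η ≤ 0 := div_nonpos_iff.2 (Or.inr ⟨by linarith [hu.2], hη.le⟩)
    have hb : -u / η ≤ 0 := div_nonpos_iff.2 (Or.inr ⟨by linarith [hu.1], hη.le⟩)
    have hA : (u - 1) * (deriv χ ((u - 1) / η) * (1 / η)) = 0 := by
      rcases eq_or_lt_of_le hu.2 with h | h
      · rw [h, sub_self, zero_mul]
      · rw [hχ'0 _ (div_neg_of_neg_of_pos (by linarith) hη), zero_mul, mul_zero]
    have hB : u * (deriv χ (-u / η) * (-1 / η)) = 0 := by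
      rcases eq_or_lt_of_le hu.1 with h | h
      · rw [← h, zero_mul]
      · rw [hχ'0 _ (div_neg_of_neg_of_pos (by linarith) hη), zero_mul, mul_zero]
    rw [hA, hB, hχ0 _ ha, hχ0 _ hb]
    ring
  · -- range in `[−η, 1+η]`
    beta_reduce
    rcases le_or_gt u 0 with hu0 | hu0
    · -- `u ≤ 0`: `σ u = u·(1 − χ(−u∕η)) ∈ [−η, 0]`
      have ha : (u - 1) / η ≤ 0 := div_nonpos_iff.2 (Or.inr ⟨by linarith, hη.le⟩)
      have hval : u - (u - 1) * χ ((u - 1) / η) - u * χ (-u / η) = u * (1 - χ (-u / η)) := by rw [hχ0 _ ha]; ring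
      rw [hval]
      refine ⟨?_, ?_⟩
      · rcases le_or_gt (-u) η with h | h
        · nlinarith [hχnn (-u / η), hχle (-u / η)]
        · have h1 : 1 ≤ -u / η := by rw [le_div_iff₀ hη]; linarith
          rw [hχ1' _ h1]; nlinarith
      · nlinarith [hχnn (-u / η), hχle (-u / η)]
    rcases le_or_gt u 1 with hu1 | hu1
    · -- `0 < u ≤ 1`: `σ u = u`
      have ha : (u - 1) / η ≤ 0 := div_nonpos_iff.2 (Or.inr ⟨by linarith, hη.le⟩)
      have hb : -u / η ≤ 0 := div_nonpos_iff.2 (Or.inr ⟨by linarith, hη.le⟩)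
      rw [hχ0 _ ha, hχ0 _ hb]
      constructor <;> nlinarith
    · -- `1 < u`: `σ u = 1 + (u − 1)·(1 − χ((u−1)∕η)) ∈ [1, 1+η]`
      have hb : -u / η ≤ 0 := div_nonpos_iff.2 (Or.inr ⟨by linarith, hη.le⟩)
      have hval : u - (u - 1) * χ ((u - 1) / η) - u * χ (-u / η) = 1 + (u - 1) * (1 - χ ((u - 1) / η)) := by
        rw [hχ0 _ hb]; ring
      rw [hval]
      refine ⟨by nlinarith [hχnn ((u - 1) / η), hχle ((u - 1) / η)], ?_⟩
      rcases le_or_gt (u - 1) η with h | h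
      · nlinarith [hχnn ((u - 1) / η), hχle ((u - 1) / η)]
      · have h1 : 1 ≤ (u - 1) / η := by rw [le_div_iff₀ hη]; linarith
        rw [hχ1' _ h1]; linarith

end Clamp

/-! ## §2 One class: the mixture path (m-geodesic) on a finite non-null piece with bounded log-density -/
section OneClass

variable {Ω : Type*} [MeasurableSpace Ω] {μ : Measure Ω} [IsFiniteMeasure μ] [NeZero μ]
  {ψ₁ ρ : Ω → ℝ} {M Z : ℝ} {Φ Φ' : ℝ → Ω → ℝ}

/-- Bookkeeping for the mixture path on a finite non-null piece (`|ψ₁| ≤ M`, `m = μ(Ω) > 0`, `Z = ∫e^{ψ₁}dμ ∕ m`, `ρ = e^{ψ₁}∕Z`): `e^{−M} ≤ Z ≤ e^{M}`,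
`e^{−2M} ≤ ρ ≤ e^{2M}`, `ρ` measurable and integrable with `∫ρ dμ = m`, and `∫e^{ψ₁}dμ = Z·m`. [folklore; lens K13 `mixturePath_aux`, CREDITED] -/
theorem mixture_aux (hψm : Measurable ψ₁) (hψb : ∀ x, |ψ₁ x| ≤ M) (hZ : Z = (∫ x, Real.exp (ψ₁ x) ∂μ) / μ.real Set.univ)
    (hρ : ∀ x, ρ x = Real.exp (ψ₁ x) / Z) :
    0 < μ.real Set.univ ∧ 0 < Z ∧ Real.exp (-M) ≤ Z ∧ Z ≤ Real.exp M ∧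
      (∀ x, Real.exp (-(2 * M)) ≤ ρ x ∧ ρ x ≤ Real.exp (2 * M)) ∧ Measurable ρ ∧ Integrable ρ μ ∧
      ∫ x, ρ x ∂μ = μ.real Set.univ ∧ ∫ x, Real.exp (ψ₁ x) ∂μ = Z * μ.real Set.univ := by
  have hm : 0 < μ.real Set.univ := measureReal_univ_pos
  have hint : Integrable (fun x => Real.exp (ψ₁ x)) μ :=
    N19TiltPathCalculus.integrable_of_abs_le (Real.measurable_exp.comp hψm) fun x => by
      rw [Real.abs_exp]; exact Real.exp_le_exp.2 ((le_abs_self _).trans (hψb x))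
  have hlo : Real.exp (-M) * μ.real Set.univ ≤ ∫ x, Real.exp (ψ₁ x) ∂μ := by
    have := integral_mono (integrable_const (Real.exp (-M))) hint fun x =>
      Real.exp_le_exp.2 (by linarith [hψb x, neg_abs_le (ψ₁ x)])
    rwa [integral_const, smul_eq_mul, mul_comm] at this
  have hhi : ∫ x, Real.exp (ψ₁ x) ∂μ ≤ Real.exp M * μ.real Set.univ := by
    have := integral_mono hint (integrable_const (Real.exp M)) fun x =>
      Real.exp_le_exp.2 ((le_abs_self _).trans (hψb x))
    rwa [integral_const, smul_eq_mul, mul_comm] at this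
  have hZlo : Real.exp (-M) ≤ Z := by rw [hZ, le_div_iff₀ hm]; exact hlo
  have hZhi : Z ≤ Real.exp M := by rw [hZ, div_le_iff₀ hm]; exact hhi
  have hZpos : 0 < Z := (Real.exp_pos _).trans_le hZlo
  have hρeq : ρ = fun x => Real.exp (ψ₁ x) / Z := funext hρ
  have hρm : Measurable ρ := by rw [hρeq]; exact (Real.measurable_exp.comp hψm).div_const Z
  have hρi : Integrable ρ μ := by rw [hρeq]; exact hint.div_const Z
  have hIZ : ∫ x, Real.exp (ψ₁ x) ∂μ = Z * μ.real Set.univ := by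
    rw [hZ, div_mul_cancel₀ _ hm.ne']
  have hρ1 : ∫ x, ρ x ∂μ = μ.real Set.univ := by
    rw [hρeq, integral_div, hIZ, mul_div_cancel_left₀ _ hZpos.ne']
  refine ⟨hm, hZpos, hZlo, hZhi, fun x => ⟨?_, ?_⟩, hρm, hρi, hρ1, hIZ⟩
  · rw [hρ, le_div_iff₀ hZpos]
    calc Real.exp (-(2 * M)) * Z ≤ Real.exp (-(2 * M)) * Real.exp M :=
          mul_le_mul_of_nonneg_left hZhi (Real.exp_pos _).le
      _ = Real.exp (-M) := by rw [← Real.exp_add]; ring_nf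
      _ ≤ Real.exp (ψ₁ x) := Real.exp_le_exp.2 (by linarith [hψb x, neg_abs_le (ψ₁ x)])
  · rw [hρ, div_le_iff₀ hZpos]
    calc Real.exp (ψ₁ x) ≤ Real.exp M := Real.exp_le_exp.2 ((le_abs_self _).trans (hψb x))
      _ = Real.exp (2 * M) * Real.exp (-M) := by rw [← Real.exp_add]; ring_nf
      _ ≤ Real.exp (2 * M) * Z := mul_le_mul_of_nonneg_left hZlo (Real.exp_pos _).le

/-- **POSITIVITY ON THE CLAMP RANGE.**  With `η = e^{−2M}∕2`, for every `s ∈ [−η, 1 + η]` and every point the mixture weight satisfies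
`e^{−2M}∕2 ≤ (1 − s) + s·ρ ≤ 2 + 2e^{2M}` (on `[0,1]` it is a convex combination of `1` and `ρ ≥ e^{−2M}`; the margins `η` absorb the two overshoots). [folklore] -/
theorem mixture_pos (hψm : Measurable ψ₁) (hψb : ∀ x, |ψ₁ x| ≤ M) (hZ : Z = (∫ x, Real.exp (ψ₁ x) ∂μ) / μ.real Set.univ)
    (hρ : ∀ x, ρ x = Real.exp (ψ₁ x) / Z) {s : ℝ} (hs : -(Real.exp (-(2 * M)) / 2) ≤ s ∧ s ≤ 1 + Real.exp (-(2 * M)) / 2) (x : Ω) :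
    Real.exp (-(2 * M)) / 2 ≤ (1 - s) + s * ρ x ∧ (1 - s) + s * ρ x ≤ 2 + 2 * Real.exp (2 * M) := by
  obtain ⟨-, -, -, -, hρb, -⟩ := mixture_aux hψm hψb hZ hρ
  obtain ⟨hlo, hhi⟩ := hρb x
  set L := Real.exp (-(2 * M)) with hL
  set a := ρ x with ha
  have hM0 : 0 ≤ M := (abs_nonneg _).trans (hψb x)
  have hL1 : L ≤ 1 := by rw [hL]; exact Real.exp_le_one_iff.2 (by linarith)
  have hLpos : 0 < L := Real.exp_pos _
  have hLE : L * Real.exp (2 * M) = 1 := by rw [hL, ← Real.exp_add]; norm_num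
  have hE1 : 1 ≤ Real.exp (2 * M) := Real.one_le_exp_iff.2 (by linarith)
  refine ⟨?_, ?_⟩
  · rcases lt_or_ge s 0 with hs0 | hs0
    · -- `−η ≤ s < 0`
      rcases le_or_gt 1 a with ha1 | ha1
      · have h1 : s * (Real.exp (2 * M) - 1) ≤ s * (a - 1) := mul_le_mul_of_nonpos_left (by linarith) hs0.le
        have h2 : -(L / 2) * (Real.exp (2 * M) - 1) ≤ s * (Real.exp (2 * M) - 1) :=
          mul_le_mul_of_nonneg_right hs.1 (by linarith)
        nlinarith
      · nlinarith
    rcases le_or_gt s 1 with hs1 | hs1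
    · -- `0 ≤ s ≤ 1`: convex combination
      nlinarith [mul_le_mul_of_nonneg_left hlo hs0, mul_nonneg (sub_nonneg.2 hs1) (sub_nonneg.2 hL1)]
    · -- `1 < s ≤ 1 + η`
      rcases le_or_gt 1 a with ha1 | ha1
      · nlinarith
      · have h1 : (s - 1) * (L - 1) ≤ (s - 1) * (a - 1) := mul_le_mul_of_nonneg_left (by linarith) (by linarith)
        have h2 : L / 2 * (L - 1) ≤ (s - 1) * (L - 1) := mul_le_mul_of_nonpos_right (by linarith [hs.2]) (by linarith)
        nlinarith
  · have h1 : 1 - s ≤ 2 := by linarith [hs.1, hL1, hLpos]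
    have h2 : s * a ≤ 2 * Real.exp (2 * M) := by
      rcases lt_or_ge s 0 with hs0 | hs0
      · have : s * a ≤ 0 := mul_nonpos_of_nonpos_of_nonneg hs0.le (hLpos.le.trans hlo)
        linarith [Real.exp_pos (2 * M)]
      · exact mul_le_mul (by linarith [hs.2]) hhi (hLpos.le.trans hlo) (by norm_num)
    linarith

omit [MeasurableSpace Ω] in
/-- The mixture exponent exponentiates to the mixture WEIGHT times `e^{s·log Z}` wherever the weight is positive. [folklore; lens K13 `mixturePath_aux`] -/
theorem exp_mixture_eq (hΦ : ∀ s x, Φ s x = Real.log ((1 - s) + s * ρ x) + s * Real.log Z) {s : ℝ} {x : Ω}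
    (hpos : 0 < (1 - s) + s * ρ x) : Real.exp (Φ s x) = ((1 - s) + s * ρ x) * Real.exp (s * Real.log Z) := by
  rw [hΦ, Real.exp_add, Real.exp_log hpos]

/-- Normalisation of the mixture path: `∫ e^{Φ s} dμ = m·e^{s·log Z}` (because `∫ρ dμ = m`). [folklore; lens K13 `mixturePath_aux`, CREDITED] -/
theorem integral_exp_mixture (hψm : Measurable ψ₁) (hψb : ∀ x, |ψ₁ x| ≤ M) (hZ : Z = (∫ x, Real.exp (ψ₁ x) ∂μ) / μ.real Set.univ)
    (hρ : ∀ x, ρ x = Real.exp (ψ₁ x) / Z) (hΦ : ∀ s x, Φ s x = Real.log ((1 - s) + s * ρ x) + s * Real.log Z) {s : ℝ}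
    (hpos : ∀ x, 0 < (1 - s) + s * ρ x) :
    ∫ x, Real.exp (Φ s x) ∂μ = μ.real Set.univ * Real.exp (s * Real.log Z) := by
  obtain ⟨-, -, -, -, -, -, hρi, hρ1, -⟩ := mixture_aux hψm hψb hZ hρ
  have e1 : (fun x => Real.exp (Φ s x)) = fun x => Real.exp (s * Real.log Z) * s * ρ x + Real.exp (s * Real.log Z) * (1 - s) :=
    funext fun x => by rw [exp_mixture_eq hΦ (hpos x)]; ring
  rw [e1, integral_add (hρi.const_mul _) (integrable_const _), integral_const_mul, hρ1, integral_const, smul_eq_mul]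
  ring

/-- ★ **DRIFT (K13b).**  Along the mixture path the tilted mean of the direction is the CONSTANT `log Z` — the class log-mass ratio — at every
parameter where the weight is positive. [folklore; lens K13b `integral_dir_mixturePath`, CREDITED] -/
theorem integral_dir_mixture (hψm : Measurable ψ₁) (hψb : ∀ x, |ψ₁ x| ≤ M) (hZ : Z = (∫ x, Real.exp (ψ₁ x) ∂μ) / μ.real Set.univ)
    (hρ : ∀ x, ρ x = Real.exp (ψ₁ x) / Z) (hΦ : ∀ s x, Φ s x = Real.log ((1 - s) + s * ρ x) + s * Real.log Z)
    (hΦ' : ∀ s x, Φ' s x = (ρ x - 1) / ((1 - s) + s * ρ x) + Real.log Z) {s : ℝ} (hpos : ∀ x, 0 < (1 - s) + s * ρ x) :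
    ∫ x, Φ' s x ∂(μ.tilted (Φ s)) = Real.log Z := by
  obtain ⟨hm, -, -, -, -, -, hρi, hρ1, -⟩ := mixture_aux hψm hψb hZ hρ
  rw [integral_tilted, integral_exp_mixture hψm hψb hZ hρ hΦ hpos]
  have e : (fun x => (Real.exp (Φ s x) / (μ.real Set.univ * Real.exp (s * Real.log Z))) • Φ' s x) =
      fun x => (1 + s * Real.log Z) / μ.real Set.univ * ρ x + ((1 - s) * Real.log Z - 1) / μ.real Set.univ := by
    funext x
    have ha : (1 - s) + s * ρ x ≠ 0 := (hpos x).ne'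
    have hE : Real.exp (s * Real.log Z) ≠ 0 := (Real.exp_pos _).ne'
    rw [exp_mixture_eq hΦ (hpos x), hΦ' s x, smul_eq_mul]
    field_simp
    ring
  rw [e, integral_add (hρi.const_mul _) (integrable_const _), integral_const_mul, hρ1, integral_const, smul_eq_mul]
  field_simp
  ring

/-- ★ **OSCILLATION (K13c) — THE CALIBRATION.**  Along the mixture path the L¹-oscillation of the direction about `log Z` is the CONSTANT
`(1∕m)∫|ρ − 1|dμ` (twice the total-variation distance of the normalised endpoint laws, module VI `half_integral_abs_eq_setDiff_pos`) at every
parameter where the weight is positive. [folklore; lens K13c `osc_mixturePath_eq`, CREDITED] -/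
theorem osc_mixture_eq (hψm : Measurable ψ₁) (hψb : ∀ x, |ψ₁ x| ≤ M) (hZ : Z = (∫ x, Real.exp (ψ₁ x) ∂μ) / μ.real Set.univ)
    (hρ : ∀ x, ρ x = Real.exp (ψ₁ x) / Z) (hΦ : ∀ s x, Φ s x = Real.log ((1 - s) + s * ρ x) + s * Real.log Z)
    (hΦ' : ∀ s x, Φ' s x = (ρ x - 1) / ((1 - s) + s * ρ x) + Real.log Z) {s : ℝ} (hpos : ∀ x, 0 < (1 - s) + s * ρ x) :
    ∫ x, |Φ' s x - Real.log Z| ∂(μ.tilted (Φ s)) = (μ.real Set.univ)⁻¹ * ∫ x, |ρ x - 1| ∂μ := by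
  obtain ⟨hm, -⟩ := mixture_aux hψm hψb hZ hρ
  rw [integral_tilted, integral_exp_mixture hψm hψb hZ hρ hΦ hpos, ← integral_const_mul]
  refine integral_congr_ae (Eventually.of_forall fun x => ?_)
  have ha : (1 - s) + s * ρ x ≠ 0 := (hpos x).ne'
  have hE : Real.exp (s * Real.log Z) ≠ 0 := (Real.exp_pos _).ne'
  simp only
  rw [exp_mixture_eq hΦ (hpos x), hΦ' s x, smul_eq_mul, add_sub_cancel_right, abs_div, abs_of_pos (hpos x)]
  field_simp

omit [MeasurableSpace Ω] in
/-- **K13d (pointwise calculus).**  The mixture exponent is differentiable in the parameter wherever the weight is positive, with derivative the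
displayed direction. [folklore; lens K13d `hasDerivAt_mixturePath`, CREDITED verbatim] -/
theorem hasDerivAt_mixture (hΦ : ∀ s x, Φ s x = Real.log ((1 - s) + s * ρ x) + s * Real.log Z)
    (hΦ' : ∀ s x, Φ' s x = (ρ x - 1) / ((1 - s) + s * ρ x) + Real.log Z) (x : Ω) {s : ℝ} (hpos : 0 < (1 - s) + s * ρ x) :
    HasDerivAt (fun v => Φ v x) (Φ' s x) s := by
  have h1 : HasDerivAt (fun v : ℝ => (1 - v) + v * ρ x) (ρ x - 1) s := by
    have ha : HasDerivAt (fun v : ℝ => (1 - v)) (-1) s := by simpa using (hasDerivAt_id s).const_sub 1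
    have hb : HasDerivAt (fun v : ℝ => v * ρ x) (ρ x) s := by simpa using (hasDerivAt_id s).mul_const (ρ x)
    exact (ha.add hb).congr_deriv (by ring)
  have h2 : HasDerivAt (fun v : ℝ => Real.log ((1 - v) + v * ρ x)) ((ρ x - 1) / ((1 - s) + s * ρ x)) s := by
    simpa using h1.log hpos.ne'
  have h3 : HasDerivAt (fun v : ℝ => v * Real.log Z) (Real.log Z) s := by simpa using (hasDerivAt_id s).mul_const (Real.log Z)
  have e1 : (fun v => Φ v x) = fun v => Real.log ((1 - v) + v * ρ x) + v * Real.log Z := funext fun v => hΦ v x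
  rw [e1, hΦ']
  exact h2.add h3

/-- ★★ **THE MIXTURE PATH AS A TILT PATH WITH ROAD II∕III's LETTERS.**  On a finite non-null piece `μ` with bounded measurable log-density `ψ₁` there is a
tilt path `ψ` (direction `ψ′`) which is measurable, pointwise C¹ in the parameter ON ALL OF ℝ and locally uniformly bounded, with `ψ 0 = 0`, `ψ 1 = ψ₁`, and
along which, for every `u ∈ [0,1]`, the tilted mean of the direction IS `log Z` (`Z = ∫e^{ψ₁}dμ ∕ m`, the normalised mass ratio) and the L¹-oscillation of the
direction IS `(1∕m)∫|e^{ψ₁}∕Z − 1| dμ` (twice the total-variation distance of the normalised endpoint laws): the m-geodesic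
`log((1−u) + u·ρ) + u·log Z` re-parametrised by the clamp of §1 (`η = e^{−2M}∕2`), which changes nothing on `[0,1]`. [folklore; lens K13a–d ∘ §1] -/
theorem exists_mixturePath (hψm : Measurable ψ₁) (hψb : ∀ x, |ψ₁ x| ≤ M) (hZ : Z = (∫ x, Real.exp (ψ₁ x) ∂μ) / μ.real Set.univ)
    (hρ : ∀ x, ρ x = Real.exp (ψ₁ x) / Z) :
    ∃ ψ ψ' : ℝ → Ω → ℝ, (∀ u, Measurable (ψ u)) ∧ (∀ u, Measurable (ψ' u)) ∧ (∀ u x, HasDerivAt (fun v => ψ v x) (ψ' u x) u) ∧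
      (∀ u₀ : ℝ, ∃ ε > 0, ∃ M' : ℝ, ∀ u ∈ Metric.ball u₀ ε, ∀ x, |ψ u x| ≤ M' ∧ |ψ' u x| ≤ M') ∧
      (∀ x, ψ 0 x = 0) ∧ (∀ x, ψ 1 x = ψ₁ x) ∧
      (∀ u ∈ Icc (0 : ℝ) 1, ∫ x, ψ' u x ∂(μ.tilted (ψ u)) = Real.log Z) ∧
      ∀ u ∈ Icc (0 : ℝ) 1, ∫ x, |ψ' u x - ∫ y, ψ' u y ∂(μ.tilted (ψ u))| ∂(μ.tilted (ψ u)) =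
        (μ.real Set.univ)⁻¹ * ∫ x, |ρ x - 1| ∂μ := by
  obtain ⟨hm, hZpos, hZlo, hZhi, hρb, hρm, hρi, hρ1, hIZ⟩ := mixture_aux hψm hψb hZ hρ
  -- the clamp
  set η : ℝ := Real.exp (-(2 * M)) / 2 with hη
  have hηpos : 0 < η := by rw [hη]; positivity
  obtain ⟨σ, σ', hσd, hσ'c, hσid, hσ'1, hσr⟩ := exists_clamp hηpos
  -- the raw mixture exponent and direction
  set Φ : ℝ → Ω → ℝ := fun s x => Real.log ((1 - s) + s * ρ x) + s * Real.log Z with hΦdef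
  set Φ' : ℝ → Ω → ℝ := fun s x => (ρ x - 1) / ((1 - s) + s * ρ x) + Real.log Z with hΦ'def
  have hΦ : ∀ s x, Φ s x = Real.log ((1 - s) + s * ρ x) + s * Real.log Z := fun _ _ => rfl
  have hΦ' : ∀ s x, Φ' s x = (ρ x - 1) / ((1 - s) + s * ρ x) + Real.log Z := fun _ _ => rfl
  have hposσ : ∀ u x, Real.exp (-(2 * M)) / 2 ≤ (1 - σ u) + σ u * ρ x ∧ (1 - σ u) + σ u * ρ x ≤ 2 + 2 * Real.exp (2 * M) :=
    fun u x => mixture_pos hψm hψb hZ hρ (s := σ u) ⟨by rw [← hη]; exact (hσr u).1, by rw [← hη]; exact (hσr u).2⟩ x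
  have hpos' : ∀ u x, 0 < (1 - σ u) + σ u * ρ x := fun u x => (div_pos (Real.exp_pos _) two_pos).trans_le (hposσ u x).1
  -- global bounds for the clamped exponent and the raw direction
  have hlogZ : |Real.log Z| ≤ M := by
    rw [abs_le]
    exact ⟨by rw [← Real.log_exp (-M)]; exact Real.log_le_log (Real.exp_pos _) hZlo,
      by rw [← Real.log_exp M]; exact Real.log_le_log hZpos hZhi⟩
  set C₀ : ℝ := max |Real.log (Real.exp (-(2 * M)) / 2)| |Real.log (2 + 2 * Real.exp (2 * M))| with hC₀
  have hΦb : ∀ u x, |Φ (σ u) x| ≤ C₀ + 2 * M := fun u x => by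
    have hlog : |Real.log ((1 - σ u) + σ u * ρ x)| ≤ C₀ :=
      abs_le_max_abs_abs (Real.log_le_log (div_pos (Real.exp_pos _) two_pos) (hposσ u x).1)
        (Real.log_le_log (hpos' u x) (hposσ u x).2)
    have hs : |σ u| ≤ 2 := by
      have hη1 : η ≤ 1 := by
        rw [hη]; have : Real.exp (-(2 * M)) ≤ 1 := Real.exp_le_one_iff.2 (by linarith [(abs_nonneg _).trans (hψb x)]); linarith
      rw [abs_le]; constructor <;> linarith [(hσr u).1, (hσr u).2]
    rw [hΦ]
    calc |Real.log ((1 - σ u) + σ u * ρ x) + σ u * Real.log Z|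
        ≤ |Real.log ((1 - σ u) + σ u * ρ x)| + |σ u * Real.log Z| := abs_add_le _ _
      _ ≤ C₀ + 2 * M := by rw [abs_mul]; exact add_le_add hlog (mul_le_mul hs hlogZ (abs_nonneg _) (by norm_num))
  set C₁ : ℝ := (Real.exp (2 * M) + 1) / (Real.exp (-(2 * M)) / 2) + M with hC₁
  have hΦ'b : ∀ u x, |Φ' (σ u) x| ≤ C₁ := fun u x => by
    rw [hΦ']
    calc |(ρ x - 1) / ((1 - σ u) + σ u * ρ x) + Real.log Z|
        ≤ |(ρ x - 1) / ((1 - σ u) + σ u * ρ x)| + |Real.log Z| := abs_add_le _ _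
      _ ≤ (Real.exp (2 * M) + 1) / (Real.exp (-(2 * M)) / 2) + M := by
          refine add_le_add ?_ hlogZ
          rw [abs_div, abs_of_pos (hpos' u x)]
          refine div_le_div₀ (by positivity) ?_ (div_pos (Real.exp_pos _) two_pos) (hposσ u x).1
          calc |ρ x - 1| ≤ |ρ x| + |(1 : ℝ)| := abs_sub _ _
            _ ≤ Real.exp (2 * M) + 1 := by
                rw [abs_one, abs_of_nonneg ((Real.exp_pos _).le.trans (hρb x).1)]; linarith [(hρb x).2]
  refine ⟨fun u x => Φ (σ u) x, fun u x => σ' u * Φ' (σ u) x, fun u => ?_, fun u => ?_, fun u x => ?_, fun u₀ => ?_,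
    fun x => ?_, fun x => ?_, fun u hu => ?_, fun u hu => ?_⟩
  · -- measurability of the exponent
    exact (Real.measurable_log.comp (measurable_const.add (hρm.const_mul _))).add measurable_const
  · -- measurability of the direction
    exact ((hρm.sub measurable_const).div (measurable_const.add (hρm.const_mul _))).add measurable_const |>.const_mul _
  · -- pointwise C¹ on ℝ (chain rule through the clamp)
    have h : HasDerivAt (fun v => Φ (σ v) x) (Φ' (σ u) x * σ' u) u :=
      (hasDerivAt_mixture hΦ hΦ' x (hpos' u x)).comp u (hσd u)
    exact h.congr_deriv (mul_comm _ _)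
  · -- local uniform bounds: the exponent is globally bounded, the direction by `C₁ · sup_{ball} |σ′|`
    obtain ⟨Cσ, hCσ⟩ := (isCompact_closedBall u₀ 1).exists_bound_of_continuousOn hσ'c.continuousOn
    refine ⟨1, one_pos, max (C₀ + 2 * M) (Cσ * C₁), fun u hu x => ⟨(hΦb u x).trans (le_max_left _ _), ?_⟩⟩
    have hσ'u : |σ' u| ≤ Cσ := by
      have := hCσ u (Metric.ball_subset_closedBall hu); rwa [Real.norm_eq_abs] at this
    calc |σ' u * Φ' (σ u) x| = |σ' u| * |Φ' (σ u) x| := abs_mul _ _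
      _ ≤ Cσ * C₁ := mul_le_mul hσ'u (hΦ'b u x) (abs_nonneg _) ((abs_nonneg _).trans hσ'u)
      _ ≤ max (C₀ + 2 * M) (Cσ * C₁) := le_max_right _ _
  · -- `ψ 0 = 0`
    show Φ (σ 0) x = 0
    rw [hσid 0 ⟨le_rfl, zero_le_one⟩, hΦ]; simp
  · -- `ψ 1 = ψ₁`
    show Φ (σ 1) x = ψ₁ x
    rw [hσid 1 ⟨zero_le_one, le_rfl⟩, hΦ, hρ]
    simp only [sub_self, one_mul, zero_add]
    rw [Real.log_div (Real.exp_pos _).ne' hZpos.ne', Real.log_exp]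
    ring
  · -- DRIFT on `[0,1]`
    have hσu : σ u = u := hσid u hu
    have hσ'u : σ' u = 1 := hσ'1 u hu
    have hposu : ∀ x, 0 < (1 - u) + u * ρ x := fun x => by simpa [hσu] using hpos' u x
    simp only [hσu, hσ'u, one_mul]
    exact integral_dir_mixture hψm hψb hZ hρ hΦ hΦ' hposu
  · -- OSC on `[0,1]`
    have hσu : σ u = u := hσid u hu
    have hσ'u : σ' u = 1 := hσ'1 u hu
    have hposu : ∀ x, 0 < (1 - u) + u * ρ x := fun x => by simpa [hσu] using hpos' u x
    simp only [hσu, hσ'u, one_mul]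
    rw [integral_dir_mixture hψm hψb hZ hρ hΦ hΦ' hposu]
    exact osc_mixture_eq hψm hψb hZ hρ hΦ hΦ' hposu

end OneClass

end Summit.QuantumFields.YangMills.BalabanUVNodes.N19TiltPathMixture

end
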